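import Literature.Computability.QuantumComplexity.InfluenceBounds
import Literature.Computability.Complexity.FourierTails
import Literature.Computability.Complexity.FourierDegree
import HarnessLib

/-!
# Granularity of the Fourier spectrum of integer-valued and Boolean functions of low degree

O'Donnell, *Analysis of Boolean Functions* (CUP 2014), Exercise 1.11(b),(c): a Boolean-valued
`f : {−1,1}ⁿ → {−1,1}` of degree `k ≥ 1` has a "`2^{1−k}`-granular" Fourier spectrum — every `f̂(S)` is an
integer multiple of `2^{1−k}` — and consequently `Σ_S |f̂(S)| ≤ 2^{k−1}`.  We prove this on top of the tree's
Fourier–Walsh expansion `cubeFourierCoeff` (`BooleanFourier.lean`), via the natural integer-valued form: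

* `exists_int_two_pow_mul_cubeFourierCoeff_of_intValued` — an INTEGER-valued `g` on `{0,1}ᴺ` whose coefficients
  vanish above level `d` has `2^d · ĝ(S) ∈ ℤ` for every `S` (induction on `d` through the twisted derivative
  `χ_i · D_i g`, of degree `≤ d − 1`, cf. `FHKLTransitiveInfluenceProofs`);
* `exists_int_two_pow_mul_cubeFourierCoeff_of_signValued` — Exercise 1.11(b): a `±1`-valued `g` with coefficients
  vanishing above level `d ≥ 1` has `2^{d−1} · ĝ(S) ∈ ℤ` (apply the integer form to `(1 − g)/2`);
* `sq_cubeFourierCoeff_ge_of_signValued` — hence every NON-ZERO coefficient has `ĝ(S)² ≥ 4^{1−d}`;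
* `sum_abs_cubeFourierCoeff_le_of_signValued` — Exercise 1.11(c): `Σ_S |ĝ(S)| ≤ 2^{d−1}` (with Parseval);
* `influence_ge_of_signValued` — polynomial form for the tree's `L²` influence
  (`Inf_i[p] = 4 Σ_{S ∋ i} p̂(S)²`, `InfluenceBounds.influence_eq_sum_sq_fourier`): a `±1`-valued real polynomial
  `p` of total degree `≤ d` (`d ≥ 1`) has `Inf_i[p] = 0` or `Inf_i[p] ≥ 4^{2−d}` for every variable `i`.

All proved; axioms `propext`, `Classical.choice`, `Quot.sound`.

References: R. O'Donnell, *Analysis of Boolean Functions*, Cambridge University Press 2014, Exercises 1.9, 1.11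
[ODonnell2014]; N. Nisan, M. Szegedy, *On the degree of Boolean functions as real polynomials*, Comput.
Complexity 4 (1994) 301–313, §2 (integer multilinear representation) [NisanSzegedy1994].
-/

noncomputable section

namespace Literature.Computability.Complexity.LowDegree

open Finset Literature.Probability.RandomGraphs.LowDegree Literature.Computability.QuantumComplexity

variable {N : ℕ}

/-! ### Small tools -/

/-- A finite sum of reals each of which is an integer is an integer. [folklore] -/
private theorem exists_int_eq_sum {ι : Type*} (s : Finset ι) (f : ι → ℝ) (h : ∀ i ∈ s, ∃ z : ℤ, f i = z) :
    ∃ z : ℤ, ∑ i ∈ s, f i = z := by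
  classical
  induction s using Finset.induction_on with
  | empty => exact ⟨0, by simp⟩
  | @insert a s ha ih =>
    obtain ⟨z₁, hz₁⟩ := h a (Finset.mem_insert_self a s)
    obtain ⟨z₂, hz₂⟩ := ih fun i hi => h i (Finset.mem_insert_of_mem hi)
    exact ⟨z₁ + z₂, by rw [Finset.sum_insert ha, hz₁, hz₂]; push_cast; ring⟩

/-- A Walsh character takes integer values (`±1`). [folklore] -/
private theorem exists_int_eq_walsh (S : Finset (Fin N)) (x : Fin N → Bool) : ∃ z : ℤ, walsh S x = z := by
  refine ⟨∏ i ∈ S, (if x i then -1 else 1 : ℤ), ?_⟩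
  unfold walsh
  push_cast
  refine Finset.prod_congr rfl fun i _ => ?_
  cases x i <;> simp [sgn]

/-- At the all-`false` point every Walsh character equals `1`. [folklore] -/
private theorem walsh_allFalse (S : Finset (Fin N)) : walsh S (fun _ : Fin N => false) = 1 := by
  unfold walsh
  exact Finset.prod_eq_one fun i _ => by simp [sgn]

/-- Multiplying by `χ_i` shifts the index set by `i`: `χ_i χ_S = χ_{S ∖ i}` (`i ∈ S`) or `χ_{S ∪ i}` (`i ∉ S`).
[folklore] -/
private theorem sgn_mul_walsh_eq (i : Fin N) (S : Finset (Fin N)) (x : Fin N → Bool) :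
    sgn (x i) * walsh S x = if i ∈ S then walsh (S.erase i) x else walsh (insert i S) x := by
  split_ifs with hi
  · rw [walsh, walsh, ← Finset.mul_prod_erase S (fun j => sgn (x j)) hi, ← mul_assoc, sgn_mul_self, one_mul]
  · rw [walsh, walsh, Finset.prod_insert hi]

/-- The coefficients of the twist `χ_i · F`: `(χ_i F)^(S) = F̂(S ∖ i)` for `i ∈ S`, `F̂(S ∪ i)` for `i ∉ S`
(the `if`-form of `FourierTails.cubeFourierCoeff_sgn_mul`, which is stated with `S ∆ {i}`). [cite: ODonnell2014, §2.2] -/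
theorem cubeFourierCoeff_sgn_mul_ite (F : (Fin N → Bool) → ℝ) (i : Fin N) (S : Finset (Fin N)) :
    cubeFourierCoeff (fun x => sgn (x i) * F x) S =
      cubeFourierCoeff F (if i ∈ S then S.erase i else insert i S) := by
  unfold cubeFourierCoeff
  congr 1
  refine Finset.sum_congr rfl fun x _ => ?_
  have h := sgn_mul_walsh_eq i S x
  calc sgn (x i) * F x * walsh S x = F x * (sgn (x i) * walsh S x) := by ring
    _ = F x * walsh (if i ∈ S then S.erase i else insert i S) x := by
        rw [h]; split_ifs <;> rfl

/-- The coefficients of `g ∘ flip_i`: `ĝ(S)` with the sign `−1` exactly when `i ∈ S`. [cite: ODonnell2014, §2.2] -/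
theorem cubeFourierCoeff_comp_flipBit (g : (Fin N → Bool) → ℝ) (i : Fin N) (S : Finset (Fin N)) :
    cubeFourierCoeff (fun x => g (flipBit i x)) S = (if i ∈ S then -1 else 1) * cubeFourierCoeff g S := by
  unfold cubeFourierCoeff
  rw [mul_div_assoc']
  congr 1
  have h := sum_flipBit i (fun x => g x * walsh S (flipBit i x))
  simp only [flipBit_flipBit] at h
  rw [h, Finset.mul_sum]
  refine Finset.sum_congr rfl fun x _ => ?_
  rw [walsh_flipBit]
  ring

/-- The coefficients of the derivative `D_i g = g − g ∘ flip_i`: `2 ĝ(S)` for `S ∋ i`, `0` otherwise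
(private copy of `QuantumComplexity.FHKL.cubeFourierCoeff_sub_flipBit`, kept local so that this file stays in the
light `BooleanFourier`/`InfluenceBounds` import cone). [cite: ODonnell2014, §2.2] -/
private theorem cubeFourierCoeff_sub_comp_flipBit (g : (Fin N → Bool) → ℝ) (i : Fin N) (S : Finset (Fin N)) :
    cubeFourierCoeff (fun x => g x - g (flipBit i x)) S = if i ∈ S then 2 * cubeFourierCoeff g S else 0 := by
  rw [show (fun x => g x - g (flipBit i x)) = fun x => g x - (fun y => g (flipBit i y)) x from rfl,
    cubeFourierCoeff_sub, cubeFourierCoeff_comp_flipBit]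
  split_ifs <;> ring

/-- The coefficient of the twisted derivative `χ_i · (g − g ∘ flip_i)` at a set `S ∌ i` is `2 ĝ(S ∪ {i})`.
[cite: ODonnell2014, §2.2] -/
theorem cubeFourierCoeff_sgn_mul_sub_flipBit_of_notMem (g : (Fin N → Bool) → ℝ) (i : Fin N)
    {S : Finset (Fin N)} (hi : i ∉ S) :
    cubeFourierCoeff (fun x => sgn (x i) * (g x - g (flipBit i x))) S = 2 * cubeFourierCoeff g (insert i S) := by
  rw [cubeFourierCoeff_sgn_mul_ite (fun x => g x - g (flipBit i x)) i S, if_neg hi, cubeFourierCoeff_sub_comp_flipBit,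
    if_pos (Finset.mem_insert_self i S)]

/-- The twisted derivative `χ_i · (g − g ∘ flip_i)` of a function of degree `≤ d + 1` has degree `≤ d`.
[cite: ODonnell2014, §2.2] -/
theorem cubeFourierCoeff_sgn_mul_sub_flipBit_eq_zero_of_lt {g : (Fin N → Bool) → ℝ} {d : ℕ}
    (hdeg : ∀ S : Finset (Fin N), d + 1 < S.card → cubeFourierCoeff g S = 0) (i : Fin N)
    {S : Finset (Fin N)} (hS : d < S.card) :
    cubeFourierCoeff (fun x => sgn (x i) * (g x - g (flipBit i x))) S = 0 := by
  rw [cubeFourierCoeff_sgn_mul_ite (fun x => g x - g (flipBit i x)) i S, cubeFourierCoeff_sub_comp_flipBit]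
  by_cases hi : i ∈ S
  · rw [if_pos hi, if_neg (Finset.notMem_erase i S)]
  · rw [if_neg hi, if_pos (Finset.mem_insert_self i S), hdeg _ (by rw [Finset.card_insert_of_notMem hi]; omega),
      mul_zero]

/-! ### Granularity for integer-valued functions of degree `≤ d` -/

/-- **`2^{-d}`-granularity of integer-valued functions of degree `≤ d`.**  If `g : {0,1}ᴺ → ℤ ⊆ ℝ` has all
Fourier–Walsh coefficients above level `d` equal to zero, then `2^d · ĝ(S)` is an integer for every `S`.
(Equivalently: the multilinear `{0,1}`-representation has integer coefficients, Nisan–Szegedy; here by induction on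
`d` through the twisted derivative `χ_i D_i g`, which is integer-valued of degree `≤ d − 1` and has coefficient
`2ĝ(S)` at `S ∖ {i}`.) [cite: ODonnell2014, Exercise 1.9 and 1.11(b)] [cite: NisanSzegedy1994, §2] -/
theorem exists_int_two_pow_mul_cubeFourierCoeff_of_intValued (d : ℕ) (g : (Fin N → Bool) → ℝ)
    (hint : ∀ x, ∃ z : ℤ, g x = z) (hdeg : ∀ S : Finset (Fin N), d < S.card → cubeFourierCoeff g S = 0)
    (S : Finset (Fin N)) : ∃ z : ℤ, (2 : ℝ) ^ d * cubeFourierCoeff g S = z := by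
  classical
  induction d generalizing g S with
  | zero =>
    -- degree `0`: `ĝ(S) = 0` for `S ≠ ∅`, and `ĝ(∅) = g(0…0)` by Fourier inversion at the all-`false` point
    by_cases hS : S.Nonempty
    · exact ⟨0, by rw [hdeg S (Finset.card_pos.mpr hS)]; simp⟩
    · rw [Finset.not_nonempty_iff_eq_empty] at hS
      subst hS
      obtain ⟨z, hz⟩ := hint (fun _ => false)
      refine ⟨z, ?_⟩
      have hinv := sum_cubeFourierCoeff_mul_walsh g (fun _ => false)
      rw [← Finset.add_sum_erase _ _ (Finset.mem_univ (∅ : Finset (Fin N)))] at hinv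
      have hrest : ∑ T ∈ (Finset.univ : Finset (Finset (Fin N))).erase ∅,
          cubeFourierCoeff g T * walsh T (fun _ => false) = 0 := by
        refine Finset.sum_eq_zero fun T hT => ?_
        rw [hdeg T (Finset.card_pos.mpr (Finset.nonempty_iff_ne_empty.mpr (Finset.ne_of_mem_erase hT))), zero_mul]
      rw [hrest, add_zero, walsh_allFalse, mul_one] at hinv
      rw [pow_zero, one_mul, hinv, hz]
  | succ d ih =>
    -- nonempty `S`: peel a variable `i ∈ S` with the twisted derivative
    have hne : ∀ S : Finset (Fin N), S.Nonempty →
        ∃ z : ℤ, (2 : ℝ) ^ (d + 1) * cubeFourierCoeff g S = z := by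
      intro S hS
      obtain ⟨i, hi⟩ := hS
      set h : (Fin N → Bool) → ℝ := fun x => sgn (x i) * (g x - g (flipBit i x)) with hh
      have hint' : ∀ x, ∃ z : ℤ, h x = z := by
        intro x
        obtain ⟨z₁, hz₁⟩ := hint x
        obtain ⟨z₂, hz₂⟩ := hint (flipBit i x)
        refine ⟨(if x i then -1 else 1) * (z₁ - z₂), ?_⟩
        rw [hh]
        dsimp only
        rw [hz₁, hz₂]
        cases x i <;> simp [sgn]
      have hdeg' : ∀ S : Finset (Fin N), d < S.card → cubeFourierCoeff h S = 0 := by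
        intro S' hS'
        exact cubeFourierCoeff_sgn_mul_sub_flipBit_eq_zero_of_lt hdeg i hS'
      obtain ⟨z, hz⟩ := ih h hint' hdeg' (S.erase i)
      refine ⟨z, ?_⟩
      rw [← hz, hh, cubeFourierCoeff_sgn_mul_sub_flipBit_of_notMem g i (Finset.notMem_erase i S),
        Finset.insert_erase hi]
      ring
    by_cases hS : S.Nonempty
    · exact hne S hS
    · -- `S = ∅`: Fourier inversion at the all-`false` point and the nonempty case
      rw [Finset.not_nonempty_iff_eq_empty] at hS
      subst hS
      obtain ⟨z₀, hz₀⟩ := hint (fun _ => false)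
      have hinv := sum_cubeFourierCoeff_mul_walsh g (fun _ => false)
      rw [← Finset.add_sum_erase _ _ (Finset.mem_univ (∅ : Finset (Fin N))), walsh_allFalse, mul_one] at hinv
      obtain ⟨z₁, hz₁⟩ := exists_int_eq_sum ((Finset.univ : Finset (Finset (Fin N))).erase ∅)
        (fun T => (2 : ℝ) ^ (d + 1) * (cubeFourierCoeff g T * walsh T (fun _ => false)))
        (fun T hT => by
          rw [walsh_allFalse, mul_one]
          exact hne T (Finset.nonempty_iff_ne_empty.mpr (Finset.ne_of_mem_erase hT)))
      refine ⟨(2 : ℤ) ^ (d + 1) * z₀ - z₁, ?_⟩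
      have e : cubeFourierCoeff g ∅ = g (fun _ => false) -
          ∑ T ∈ (Finset.univ : Finset (Finset (Fin N))).erase ∅,
            cubeFourierCoeff g T * walsh T (fun _ => false) := by
        linarith
      rw [e, mul_sub, Finset.mul_sum, hz₁, hz₀]
      push_cast
      ring

/-! ### Boolean (`±1`-valued) functions: O'Donnell's Exercise 1.11 -/

/-- **`2^{1−d}`-granularity of `±1`-valued functions of degree `≤ d`** (`d ≥ 1`): every Fourier–Walsh
coefficient of a `±1`-valued `g` on `{0,1}ᴺ` whose coefficients vanish above level `d` is an integer multiple
of `2^{1−d}`.  (The `{0,1}`-valued `(1 − g)/2` is integer-valued of degree `≤ d`.) [cite: ODonnell2014, Exercise 1.11(b)] -/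
theorem exists_int_two_pow_mul_cubeFourierCoeff_of_signValued {d : ℕ} (hd : 1 ≤ d) (g : (Fin N → Bool) → ℝ)
    (hsign : ∀ x, g x = 1 ∨ g x = -1) (hdeg : ∀ S : Finset (Fin N), d < S.card → cubeFourierCoeff g S = 0)
    (S : Finset (Fin N)) : ∃ z : ℤ, (2 : ℝ) ^ (d - 1) * cubeFourierCoeff g S = z := by
  classical
  set q : (Fin N → Bool) → ℝ := fun x => (1 / 2 : ℝ) * ((fun _ => (1 : ℝ)) x - g x) with hq
  have hq_int : ∀ x, ∃ z : ℤ, q x = z := by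
    intro x
    rcases hsign x with h | h
    · exact ⟨0, by rw [hq]; simp [h]⟩
    · exact ⟨1, by rw [hq]; simp [h]; norm_num⟩
  -- coefficients of `q`
  have hq_coef : ∀ T : Finset (Fin N), T.Nonempty → cubeFourierCoeff q T = -(1 / 2) * cubeFourierCoeff g T := by
    intro T hT
    rw [hq, cubeFourierCoeff_const_mul, cubeFourierCoeff_sub,
      Literature.Computability.Complexity.cubeFourierCoeff_eq_zero_of_forall_eq (fun _ _ => rfl) hT]
    ring
  have hq_empty : cubeFourierCoeff q ∅ = 1 / 2 - (1 / 2) * cubeFourierCoeff g ∅ := by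
    rw [hq, cubeFourierCoeff_const_mul, cubeFourierCoeff_sub, cubeFourierCoeff_empty (fun _ => (1 : ℝ))]
    rw [Finset.sum_const, Finset.card_univ, nsmul_eq_mul, mul_one]
    have : ((Fintype.card (Fin N → Bool) : ℕ) : ℝ) = (2 : ℝ) ^ N := by simp
    rw [this, div_self (by positivity)]
    ring
  have hq_deg : ∀ T : Finset (Fin N), d < T.card → cubeFourierCoeff q T = 0 := by
    intro T hT
    rw [hq_coef T (Finset.card_pos.mp (by omega)), hdeg T hT, mul_zero]
  obtain ⟨z, hz⟩ := exists_int_two_pow_mul_cubeFourierCoeff_of_intValued d q hq_int hq_deg S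
  have h2 : (2 : ℝ) ^ d = 2 * (2 : ℝ) ^ (d - 1) := by
    rw [← pow_succ']; congr 1; omega
  by_cases hS : S.Nonempty
  · refine ⟨-z, ?_⟩
    rw [hq_coef S hS, h2] at hz
    push_cast
    linarith
  · rw [Finset.not_nonempty_iff_eq_empty] at hS
    subst hS
    refine ⟨(2 : ℤ) ^ (d - 1) - z, ?_⟩
    rw [hq_empty, h2] at hz
    push_cast
    linarith

/-- Every NON-ZERO coefficient of a `±1`-valued function of degree `≤ d` (`d ≥ 1`) has `ĝ(S)² ≥ 4^{1−d}`, i.e.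
`4^{d−1} · ĝ(S)² ≥ 1`. [cite: ODonnell2014, Exercise 1.11(b)] -/
theorem one_le_four_pow_mul_sq_cubeFourierCoeff_of_signValued {d : ℕ} (hd : 1 ≤ d) (g : (Fin N → Bool) → ℝ)
    (hsign : ∀ x, g x = 1 ∨ g x = -1) (hdeg : ∀ S : Finset (Fin N), d < S.card → cubeFourierCoeff g S = 0)
    {S : Finset (Fin N)} (hS : cubeFourierCoeff g S ≠ 0) :
    1 ≤ (4 : ℝ) ^ (d - 1) * cubeFourierCoeff g S ^ 2 := by
  obtain ⟨z, hz⟩ := exists_int_two_pow_mul_cubeFourierCoeff_of_signValued hd g hsign hdeg S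
  have hz0 : z ≠ 0 := by
    rintro rfl
    rw [Int.cast_zero, mul_eq_zero] at hz
    rcases hz with h | h
    · exact absurd h (by positivity)
    · exact hS h
  have hz1 : (1 : ℝ) ≤ (z : ℝ) ^ 2 := by
    have : (1 : ℤ) ≤ z ^ 2 := by nlinarith [sq_pos_of_ne_zero hz0]
    exact_mod_cast this
  calc (1 : ℝ) ≤ (z : ℝ) ^ 2 := hz1
    _ = ((2 : ℝ) ^ (d - 1) * cubeFourierCoeff g S) ^ 2 := by rw [hz]
    _ = (4 : ℝ) ^ (d - 1) * cubeFourierCoeff g S ^ 2 := by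
        rw [mul_pow, ← pow_mul, show (4 : ℝ) = 2 ^ 2 by norm_num, ← pow_mul, mul_comm 2 (d - 1)]

/-- **Exercise 1.11(c)**: a `±1`-valued function of degree `≤ d` (`d ≥ 1`) has `Σ_S |ĝ(S)| ≤ 2^{d−1}`
(each non-zero `|ĝ(S)| ≥ 2^{1−d}`, so `|ĝ(S)| ≤ 2^{d−1} ĝ(S)²`, and `Σ_S ĝ(S)² = 1` by Parseval).
[cite: ODonnell2014, Exercise 1.11(c)] -/
theorem sum_abs_cubeFourierCoeff_le_of_signValued {d : ℕ} (hd : 1 ≤ d) (g : (Fin N → Bool) → ℝ)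
    (hsign : ∀ x, g x = 1 ∨ g x = -1) (hdeg : ∀ S : Finset (Fin N), d < S.card → cubeFourierCoeff g S = 0) :
    ∑ S : Finset (Fin N), |cubeFourierCoeff g S| ≤ (2 : ℝ) ^ (d - 1) := by
  have hpars : ∑ S : Finset (Fin N), cubeFourierCoeff g S ^ 2 = 1 := by
    rw [sum_cubeFourierCoeff_sq]
    have h1 : ∀ x, g x ^ 2 = 1 := fun x => by rcases hsign x with h | h <;> rw [h] <;> norm_num
    rw [Finset.sum_congr rfl fun x _ => h1 x, Finset.sum_const, Finset.card_univ, nsmul_eq_mul, mul_one]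
    have : ((Fintype.card (Fin N → Bool) : ℕ) : ℝ) = (2 : ℝ) ^ N := by simp
    rw [this, div_self (by positivity)]
  have hterm : ∀ S : Finset (Fin N), |cubeFourierCoeff g S| ≤ (2 : ℝ) ^ (d - 1) * cubeFourierCoeff g S ^ 2 := by
    intro S
    by_cases hS : cubeFourierCoeff g S = 0
    · rw [hS]; simp
    · obtain ⟨z, hz⟩ := exists_int_two_pow_mul_cubeFourierCoeff_of_signValued hd g hsign hdeg S
      have hz0 : z ≠ 0 := by
        rintro rfl
        rw [Int.cast_zero, mul_eq_zero] at hz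
        rcases hz with h | h
        · exact absurd h (by positivity)
        · exact hS h
      have hz1 : (1 : ℝ) ≤ |(z : ℝ)| := by
        have : (1 : ℤ) ≤ |z| := Int.one_le_abs hz0
        exact_mod_cast this
      have habs : |(z : ℝ)| = (2 : ℝ) ^ (d - 1) * |cubeFourierCoeff g S| := by
        rw [← hz, abs_mul, abs_of_pos (by positivity)]
      have ha : 0 ≤ |cubeFourierCoeff g S| := abs_nonneg _
      calc |cubeFourierCoeff g S| = |cubeFourierCoeff g S| * 1 := (mul_one _).symm
        _ ≤ |cubeFourierCoeff g S| * ((2 : ℝ) ^ (d - 1) * |cubeFourierCoeff g S|) := by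
            rw [← habs]; exact mul_le_mul_of_nonneg_left hz1 ha
        _ = (2 : ℝ) ^ (d - 1) * cubeFourierCoeff g S ^ 2 := by rw [← sq_abs]; ring
  calc ∑ S : Finset (Fin N), |cubeFourierCoeff g S|
      ≤ ∑ S : Finset (Fin N), (2 : ℝ) ^ (d - 1) * cubeFourierCoeff g S ^ 2 := Finset.sum_le_sum fun S _ => hterm S
    _ = (2 : ℝ) ^ (d - 1) := by rw [← Finset.mul_sum, hpars, mul_one]

/-! ### Polynomial form: influences of `±1`-valued low-degree polynomials are `0` or `≥ 4^{2−d}` -/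

/-- For a real polynomial `p` that is `±1`-valued on the cube and has total degree `≤ d` (`d ≥ 1`), every variable
`i` has `Inf_i[p] = 0` or `4^{2−d} ≤ Inf_i[p]` (tree normalisation `Inf_i[p] = E_x (p(x) − p(x^i))² =
4 Σ_{S ∋ i} p̂(S)²`): an influential variable lies in some `S` with `p̂(S) ≠ 0`, and `p̂(S)² ≥ 4^{1−d}`.
[cite: ODonnell2014, Exercise 1.11(b) and §2.2] -/
theorem influence_eq_zero_or_ge_of_signValued {d : ℕ} (hd : 1 ≤ d) (p : MvPolynomial (Fin N) ℝ)
    (hp : p.totalDegree ≤ d) (hsign : ∀ x, evalBool p x = 1 ∨ evalBool p x = -1) (i : Fin N) :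
    influence i p = 0 ∨ (4 : ℝ) / (4 : ℝ) ^ (d - 1) ≤ influence i p := by
  classical
  have hdeg : ∀ S : Finset (Fin N), d < S.card → cubeFourierCoeff (evalBool p) S = 0 :=
    fun S hS => cubeFourierCoeff_evalBool_eq_zero hp hS
  rw [influence_eq_sum_sq_fourier]
  by_cases h : ∃ S : Finset (Fin N), i ∈ S ∧ cubeFourierCoeff (evalBool p) S ≠ 0
  · right
    obtain ⟨S, hiS, hS⟩ := h
    have h1 := one_le_four_pow_mul_sq_cubeFourierCoeff_of_signValued hd (evalBool p) hsign hdeg hS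
    have h4 : (0 : ℝ) < (4 : ℝ) ^ (d - 1) := by positivity
    have hle : cubeFourierCoeff (evalBool p) S ^ 2 ≤
        ∑ T ∈ Finset.univ.filter (fun T : Finset (Fin N) => i ∈ T), cubeFourierCoeff (evalBool p) T ^ 2 :=
      Finset.single_le_sum (f := fun T => cubeFourierCoeff (evalBool p) T ^ 2) (fun T _ => sq_nonneg _)
        (Finset.mem_filter.mpr ⟨Finset.mem_univ S, hiS⟩)
    rw [div_le_iff₀ h4]
    calc (4 : ℝ) = 4 * 1 := (mul_one _).symm
      _ ≤ 4 * ((4 : ℝ) ^ (d - 1) * cubeFourierCoeff (evalBool p) S ^ 2) := by linarith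
      _ ≤ 4 * ((4 : ℝ) ^ (d - 1) * ∑ T ∈ Finset.univ.filter (fun T : Finset (Fin N) => i ∈ T),
            cubeFourierCoeff (evalBool p) T ^ 2) := by gcongr
      _ = 4 * (∑ T ∈ Finset.univ.filter (fun T : Finset (Fin N) => i ∈ T),
            cubeFourierCoeff (evalBool p) T ^ 2) * (4 : ℝ) ^ (d - 1) := by ring
  · left
    push Not at h
    rw [Finset.sum_eq_zero fun T hT => by rw [h T (Finset.mem_filter.mp hT).2]; ring, mul_zero]

end Literature.Computability.Complexity.LowDegree

end
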